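import Summits.AtomisticToContinuum.Crystallization.Theorems.SquareWellLayerCakeTwelveWithinOneHcpRootGeometry

/-!
# Crux `GappedShellCensus.RadialDefectsVanish` (stmt-AtomisticToContinuum-15930), line `palm-pinned-scale`:
# the crux's radial predicate with inward slack at the root of a rotated relaxed hcp crystal

Stub `stub_hcpRootRadial` of the checked skeleton `Cruxes/RadialDefectsVanish/Lines/palm-pinned-scale.lean`
(pure hcp geometry).  For `0 < σ ≤ 1/100`, in-layer bond `a` and interlayer bond `b = √(a²/3 + h²)` both
in `[55/57 + σ, 1 − σ]`, `0 < h`, and a linear isometry `A` of `ℝ³`, the configuration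
`count|A(hcpStacking a h)` satisfies:

* ALL atoms are pairwise `(55/57 + σ)`-separated (landed:
  `SquareWellLayerCakeTwelveWithinOne.le_dist_of_mem_hcpStacking`);
* RADIAL GAP: every atom `w ≠ 0` has `‖w‖ ≤ 1 − σ` or `‖w‖ ≥ 21/17 + σ` — the squared distance of a
  site from the root is `a²`, `b²` (both `≤ (1 − σ)²`) or at least one of `3a²`, `4a²/3 + h² = a² + b²`,
  `4h²` (`EnergyDerivativeOrderLimitTransfer.dist_sq_cases_of_mem`), and in the bond box each of the
  three is `≥ 1.86 > (21/17 + 1/100)² = 1.5508`;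
* EXACTLY TWELVE: the atoms `w ≠ 0` with `‖w‖ ≤ 1 − σ` are exactly the (images of the) twelve
  first-shell sites of the root (`EnergyDerivativeOrderLimitTransfer.ncard_shell` with `ρ = 1 − σ`).

So at the pinned scale `a₀ = 50/51` (window `[49/51, 1] ⊃ [55/57, 1]`, gap up to `21/17 = 1.26·a₀`)
the root of a rotated relaxed hcp crystal is gapped-twelve with slack.
-/

noncomputable section

open MeasureTheory Set

namespace Summit.AtomisticToContinuum.Crystallization.Theorems.RadialDefectsVanishPalmPinnedScale

open Literature.MathematicalPhysics.StatisticalMechanics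
open Literature.Probability.Process (count_restrict_singleton_ne_zero_iff)
open Summit.AtomisticToContinuum.Crystallization.Theorems.EnergyDerivativeOrderLimitTransfer
  (dist_sq_cases_of_mem ncard_shell)
open Summit.AtomisticToContinuum.Crystallization.Theorems.SquareWellLayerCakeTwelveWithinOne
  (bondBox_numerics le_dist_of_mem_hcpStacking)

local notation "E3" => EuclideanSpace ℝ (Fin 3)

/-- **Numeric side conditions for the radial gap.**  In the bond box (`55/57 + σ ≤ a ≤ 1 − σ`,
`55/57 + σ ≤ √(a²/3+h²) ≤ 1 − σ`, `0 < σ ≤ 1/100`) each of `3a²`, `4a²/3 + h²`, `4h²` is at least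
`(21/17 + σ)²`. [folklore] -/
theorem gapBox_numerics {σ a h : ℝ} (hσ : 0 < σ) (hσ1 : σ ≤ 1 / 100) (ha1 : 55 / 57 + σ ≤ a)
    (ha2 : a ≤ 1 - σ) (hb1 : 55 / 57 + σ ≤ Real.sqrt (a ^ 2 / 3 + h ^ 2))
    (hb2 : Real.sqrt (a ^ 2 / 3 + h ^ 2) ≤ 1 - σ) :
    (21 / 17 + σ) ^ 2 ≤ 3 * a ^ 2 ∧ (21 / 17 + σ) ^ 2 ≤ 4 * a ^ 2 / 3 + h ^ 2 ∧
      (21 / 17 + σ) ^ 2 ≤ 4 * h ^ 2 := by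
  have hm0 : (0 : ℝ) < 55 / 57 + σ := by positivity
  have hmsq : (55 / 57 + σ) ^ 2 ≤ a ^ 2 / 3 + h ^ 2 := (Real.le_sqrt' hm0).1 hb1
  have hbsq : a ^ 2 / 3 + h ^ 2 ≤ (1 - σ) ^ 2 := (Real.sqrt_le_iff.1 hb2).2
  have ha0 : 0 < a := hm0.trans_le ha1
  have hma : (55 / 57 + σ) ^ 2 ≤ a ^ 2 := by nlinarith
  have hm2 : (55 / 57 : ℝ) ^ 2 ≤ (55 / 57 + σ) ^ 2 := by nlinarith
  have hasq : a ^ 2 ≤ (1 - σ) ^ 2 := by nlinarith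
  have hg : (21 / 17 + σ) ^ 2 ≤ (21 / 17 + 1 / 100 : ℝ) ^ 2 := by nlinarith
  refine ⟨?_, ?_, ?_⟩
  · nlinarith
  · nlinarith
  · nlinarith

/-- **Radial gap at the root of the relaxed hcp stacking**: a site `x ≠ 0` of `hcpStacking a h` (bond
box as above) has `‖x‖ ≤ 1 − σ` or `21/17 + σ ≤ ‖x‖`. [folklore] -/
theorem norm_le_or_le_norm_of_mem_hcpStacking {σ a h : ℝ} (hσ : 0 < σ) (hσ1 : σ ≤ 1 / 100)
    (ha1 : 55 / 57 + σ ≤ a) (ha2 : a ≤ 1 - σ) (hb1 : 55 / 57 + σ ≤ Real.sqrt (a ^ 2 / 3 + h ^ 2))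
    (hb2 : Real.sqrt (a ^ 2 / 3 + h ^ 2) ≤ 1 - σ) {x : E3} (hx : x ∈ hcpStacking a h) (hx0 : x ≠ 0) :
    ‖x‖ ≤ 1 - σ ∨ 21 / 17 + σ ≤ ‖x‖ := by
  obtain ⟨hg1, hg2, hg3⟩ := gapBox_numerics hσ hσ1 ha1 ha2 hb1 hb2
  have hbsq : a ^ 2 / 3 + h ^ 2 ≤ (1 - σ) ^ 2 := (Real.sqrt_le_iff.1 hb2).2
  have hρ0 : (0 : ℝ) ≤ 1 - σ := by linarith
  have hg0 : (0 : ℝ) ≤ 21 / 17 + σ := by positivity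
  have h0 : (0 : E3) ∈ hcpStacking a h := ⟨0, 0, 0, (barlowPos_alternating_zero a h).symm⟩
  have hnorm : ‖x‖ = dist x 0 := (dist_zero_right x).symm
  rw [hnorm]
  rcases dist_sq_cases_of_mem isHaggSeq_alternating hx h0 hx0 with hd | hd | hd | hd | hd
  · left
    have hasq : a ^ 2 ≤ (1 - σ) ^ 2 := by nlinarith
    exact (pow_le_pow_iff_left₀ dist_nonneg hρ0 two_ne_zero).1 (hd ▸ hasq)
  · left
    exact (pow_le_pow_iff_left₀ dist_nonneg hρ0 two_ne_zero).1 (hd ▸ hbsq)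
  · right
    exact (pow_le_pow_iff_left₀ hg0 dist_nonneg two_ne_zero).1 (hg1.trans hd)
  · right
    exact (pow_le_pow_iff_left₀ hg0 dist_nonneg two_ne_zero).1 (hg2.trans hd)
  · right
    exact (pow_le_pow_iff_left₀ hg0 dist_nonneg two_ne_zero).1 (hg3.trans hd)

/-- **STUB `stub_hcpRootRadial` (pure hcp geometry)** — THE CRUX'S RADIAL PREDICATE WITH SLACK AT THE
ROOT OF A ROTATED RELAXED hcp CRYSTAL: if `a` and `√(a²/3+h²)` lie in `[55/57 + σ, 1 − σ]`
(`0 < σ ≤ 1/100`, `h > 0`) then in `count|A(hcpStacking a h)` all atoms are pairwise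
`(55/57 + σ)`-separated, every atom `w ≠ 0` has `‖w‖ ≤ 1 − σ` or `‖w‖ ≥ 21/17 + σ`, and the atoms
`w ≠ 0` with `‖w‖ ≤ 1 − σ` are exactly twelve (the rotated first shell of the root). [folklore] -/
theorem stub_hcpRootRadial :
    ∀ σ a h : ℝ, 0 < σ → σ ≤ 1 / 100 →
      55 / 57 + σ ≤ a → a ≤ 1 - σ →
      55 / 57 + σ ≤ Real.sqrt (a ^ 2 / 3 + h ^ 2) → Real.sqrt (a ^ 2 / 3 + h ^ 2) ≤ 1 - σ → 0 < h →
      ∀ A : E3 ≃ₗᵢ[ℝ] E3,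
      (∀ w w' : E3, (Measure.count : Measure E3).restrict (A '' hcpStacking a h) {w} ≠ 0 →
          (Measure.count : Measure E3).restrict (A '' hcpStacking a h) {w'} ≠ 0 → w ≠ w' →
          55 / 57 + σ ≤ dist w w') ∧
        (∀ w : E3, (Measure.count : Measure E3).restrict (A '' hcpStacking a h) {w} ≠ 0 → w ≠ 0 →
          (‖w‖ ≤ 1 - σ ∨ 21 / 17 + σ ≤ ‖w‖)) ∧
        ∃ T : Finset E3, T.card = 12 ∧
          (∀ w ∈ T, (Measure.count : Measure E3).restrict (A '' hcpStacking a h) {w} ≠ 0 ∧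
            w ≠ 0 ∧ ‖w‖ ≤ 1 - σ) ∧
          ∀ w : E3, (Measure.count : Measure E3).restrict (A '' hcpStacking a h) {w} ≠ 0 → w ≠ 0 →
            ‖w‖ ≤ 1 - σ → w ∈ T := by
  intro σ a h hσ hσ1 ha1 ha2 hb1 hb2 hh A
  refine ⟨?_, ?_, ?_⟩
  · -- (i) separation of all pairs: `A` is an isometry and the stacking is `(55/57 + σ)`-separated
    intro w w' hw hw' hne
    rw [count_restrict_singleton_ne_zero_iff] at hw hw'
    obtain ⟨x, hx, rfl⟩ := hw
    obtain ⟨x', hx', rfl⟩ := hw'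
    rw [LinearIsometryEquiv.dist_map]
    exact le_dist_of_mem_hcpStacking hσ ha1 ha2 hb1 hb2 hx hx' fun hxx' => hne (by rw [hxx'])
  · -- (ii) the radial gap, transported by `A`
    intro w hw hw0
    rw [count_restrict_singleton_ne_zero_iff] at hw
    obtain ⟨x, hx, rfl⟩ := hw
    have hx0 : x ≠ 0 := fun h0 => hw0 (by rw [h0, LinearIsometryEquiv.map_zero])
    rw [LinearIsometryEquiv.norm_map]
    exact norm_le_or_le_norm_of_mem_hcpStacking hσ hσ1 ha1 ha2 hb1 hb2 hx hx0
  · -- (iii) exactly the twelve first-shell sites of the root, rotated by `A`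
    obtain ⟨-, -, hρ1, hρ2, hρ3⟩ := bondBox_numerics hσ ha1 ha2 hb1 hb2
    have ha0 : 0 < a := by linarith
    have h0 : (0 : E3) ∈ hcpStacking a h := ⟨0, 0, 0, (barlowPos_alternating_zero a h).symm⟩
    set Sh : Set E3 := {w | w ∈ hcpStacking a h ∧ w ≠ 0 ∧ dist (0 : E3) w ≤ 1 - σ} with hSh
    have hcard : Sh.ncard = 12 :=
      ncard_shell isHaggSeq_alternating ha0 hh.ne' ha2 hb2 hρ1 hρ2 hρ3 h0
    have hfin : Sh.Finite := Set.finite_of_ncard_ne_zero (by rw [hcard]; norm_num)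
    refine ⟨hfin.toFinset.image A, ?_, ?_, ?_⟩
    · rw [Finset.card_image_of_injective _ A.injective, ← Set.ncard_eq_toFinset_card Sh hfin, hcard]
    · intro w hw
      rw [Finset.mem_image] at hw
      obtain ⟨x, hx, rfl⟩ := hw
      rw [Set.Finite.mem_toFinset] at hx
      obtain ⟨hxS, hx0, hxd⟩ := hx
      refine ⟨(count_restrict_singleton_ne_zero_iff _ _).2 ⟨x, hxS, rfl⟩, ?_, ?_⟩
      · intro hAx
        exact hx0 (A.injective (by rw [hAx, LinearIsometryEquiv.map_zero]))
      · rw [LinearIsometryEquiv.norm_map, ← dist_zero_left]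
        exact hxd
    · intro w hw hw0 hwn
      rw [count_restrict_singleton_ne_zero_iff] at hw
      obtain ⟨x, hx, rfl⟩ := hw
      have hx0 : x ≠ 0 := fun h0' => hw0 (by rw [h0', LinearIsometryEquiv.map_zero])
      rw [LinearIsometryEquiv.norm_map] at hwn
      refine Finset.mem_image.2 ⟨x, ?_, rfl⟩
      rw [Set.Finite.mem_toFinset]
      exact ⟨hx, hx0, by rwa [dist_zero_left]⟩

end Summit.AtomisticToContinuum.Crystallization.Theorems.RadialDefectsVanishPalmPinnedScale

end
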